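import Mathlib.RepresentationTheory.Irreducible
import Mathlib.Algebra.Module.LinearMap.Rat
import Mathlib.LinearAlgebra.Dimension.Free
import Mathlib.LinearAlgebra.Dimension.Constructions
import Mathlib.LinearAlgebra.FiniteDimensional.Lemmas
import HarnessLib

/-!
# Wedderburn certificates I: a finite, checkable substitute for "irreducible, pairwise disjoint, of known commutant"

COR-CM (cell `pub-hodgecm2`, binder seat `b16` gen 58, count-neutral claim CERTIFICATES, file F1 — abstract finite-group
level; theorems only, no definition, no named fact, no `sorry`).  NEW as stated, hence under `Summits/`.  HONEST FRAMING:
finite-dimensional linear algebra over `ℚ`; it serves the census use of Mai's multiplicity formula for the rank of (families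
of) CM types (`CorCM/IrreducibleOddWeightsMultiplicity*`, gen 57), whose three representation-theoretic hypotheses — the
listed `ℚ`-representations `(π_k, V_k)` of `G` are IRREDUCIBLE, PAIRWISE DISJOINT (no intertwiner) and COVER the module —
and whose weights `d_k / δ_k` (`δ_k = dim_ℚ End_G V_k`) a census seat would otherwise have to establish by representation
theory.  `HC_CM` is neither used nor asserted.

THE CERTIFICATE (data a census seat can exhibit and check by finite linear algebra).  A finite group `G`; finitely many
`ℚ`-representations `π_k : G → GL(V_k)`; for each `k` a DIVISION RING `Z_k` acting on `V_k` such that every `π_k(g)` is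
`Z_k`-linear (`π_k(g)(z • v) = z • π_k(g) v`; `r_k = dim_{Z_k} V_k`, `d_k = dim_ℚ V_k`); a "test space" `C ≤ ℚ^G`
(all of `ℚ^G`, or its odd half `{c : c(ρg) = −c(g)}` for a central involution `ρ` — file F2) with

* (COUNT)  `Σ_k r_k · d_k ≤ dim_ℚ C`  (for `C = ℚ^G`: `Σ_k r_k² [Z_k:ℚ] = |G|`, Wedderburn's count), and
* (FAITHFUL)  `c ∈ C` and `Σ_g c(g) π_k(g) = 0` for every `k` ⟹ `c = 0`.

CONCLUSIONS (this file): §1 **`exists_mem_forall_sum_smul_eq`** — every family `(f_k)` of `Z_k`-linear endomorphisms is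
`(Σ_g c(g) π_k(g))_k` for some `c ∈ C` (the map `C → ∏_k End_{Z_k}(V_k)` is onto: injective by FAITHFUL, and
`dim End_{Z_k}(V_k) ≤ r_k d_k` by evaluating on a `Z_k`-basis); §2 **`intertwiningMap_eq_zero_of_certificate`** (PAIRWISE
DISJOINT: `Hom_G(V_k, V_l) = 0` for `k ≠ l`), **`exists_smul_eq_of_certificate`** (THE COMMUTANT: every `G`-endomorphism
of `V_k` is `v ↦ t • v` for a unique `t ∈ Z_k` — so `End_G V_k ≅ Z_k`), **`finrank_intertwiningMap_mul_eq_of_certificate`**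
(`δ_k · r_k = d_k`, i.e. the weight `d_k/δ_k` of Mai's formula IS `r_k`), **`isIrreducible_of_certificate`** (IRREDUCIBLE).
File F2 adds COVERING and packages the full and the odd certificate.  No Schur index restriction: `Z_k` may be a
quaternion algebra.

## References

* [Serre1977] J.-P. Serre, *Linear Representations of Finite Groups*, GTM 42 (1977), §6.5 Prop. 16 and §12.2 (the
  decomposition `ℚ[G] ≅ ∏ M_{n_i}(D_i)` and the count `|G| = Σ n_i² [D_i:ℚ]`).
* [Mai1989] L. Mai, *Lower bounds for the ranks of CM types*, J. Number Theory 32 (1989), §2 Prop. 1.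
-/

set_option autoImplicit false

noncomputable section

open scoped BigOperators

universe u u' v w

namespace Summit.HodgeConjecture.CorCM.IrrOdd

variable {G : Type w} [Group G] [Fintype G]
variable {K : Type u'} [Fintype K]
variable {V : K → Type v} [∀ k, AddCommGroup (V k)] [∀ k, Module ℚ (V k)] [∀ k, FiniteDimensional ℚ (V k)]
variable {Z : K → Type u} [∀ k, DivisionRing (Z k)] [∀ k, Module (Z k) (V k)] [∀ k, Module.Finite (Z k) (V k)]

/-! ### §0 `Z`-linear `ℚ`-endomorphisms -/

section ZLinear

variable {W : Type*} [AddCommGroup W] [Module ℚ W] {D : Type*} [DivisionRing D] [Module D W]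

omit [Fintype G] [Fintype K] in
/-- `D`-scalars commute with `ℚ`-scalars on any `D`-module that is also a `ℚ`-vector space (additive maps are `ℚ`-linear).
[folklore] -/
theorem smul_rat_smul_comm (z : D) (q : ℚ) (w : W) : z • q • w = q • z • w :=
  map_rat_smul (DistribSMul.toAddMonoidHom W z) q w

omit [Fintype G] [Fintype K] in
/-- **A `ℚ`-endomorphism commuting with the `D`-scalars is determined by its values on a `D`-basis.** [folklore] -/
theorem eq_of_forall_basis {ι : Type*} (b : Module.Basis ι D W) {f f' : W →ₗ[ℚ] W}
    (hf : ∀ (z : D) (w : W), f (z • w) = z • f w) (hf' : ∀ (z : D) (w : W), f' (z • w) = z • f' w)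
    (h : ∀ i, f (b i) = f' (b i)) : f = f' := by
  let fD : W →ₗ[D] W := { toFun := f, map_add' := f.map_add, map_smul' := hf }
  let fD' : W →ₗ[D] W := { toFun := f', map_add' := f'.map_add, map_smul' := hf' }
  have hD : fD = fD' := b.ext fun i => h i
  ext w
  exact LinearMap.congr_fun hD w

omit [Fintype K] in
/-- `Σ_g c(g) π(g)` commutes with the `D`-scalars as soon as every `π(g)` does. [folklore] -/
theorem sum_smul_apply_smul (π : Representation ℚ G W) (hlin : ∀ (g : G) (z : D) (w : W), π g (z • w) = z • π g w)
    (c : G → ℚ) (z : D) (w : W) : (∑ g, c g • π g) (z • w) = z • (∑ g, c g • π g) w := by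
  rw [LinearMap.sum_apply, LinearMap.sum_apply, Finset.smul_sum]
  refine Finset.sum_congr rfl fun g _ => ?_
  rw [LinearMap.smul_apply, LinearMap.smul_apply, hlin, smul_rat_smul_comm]

end ZLinear

/-! ### §1 The certificate makes `C → ∏_k End_{Z_k}(V_k)` onto -/

/-- **SURJECTIVITY FROM THE CERTIFICATE.**  `G` finite, `π_k` `Z_k`-linear `ℚ`-representations (`Z_k` division rings,
`r_k = dim_{Z_k} V_k`, `d_k = dim_ℚ V_k`), `C ≤ ℚ^G` with (COUNT) `Σ_k r_k d_k ≤ dim C` and (FAITHFUL) `c ∈ C`,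
`Σ_g c(g) π_k(g) = 0 ∀ k ⟹ c = 0`.  Then EVERY family `(f_k)_k` of `ℚ`-endomorphisms commuting with the `Z_k`-scalars is
`f_k = Σ_g c(g) π_k(g)` for one `c ∈ C` — `C ≅ ∏_k End_{Z_k}(V_k)` (`c ↦ (Σ_g c(g)π_k(g))_k` is injective by FAITHFUL
into a space of dimension `≤ Σ_k r_k d_k`, a `Z_k`-linear map being determined by the `r_k` values on a basis).
[cite: Serre1977, §6.5 Prop. 16 and §12.2] -/
theorem exists_mem_forall_sum_smul_eq (π : ∀ k, Representation ℚ G (V k))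
    (hlin : ∀ k (g : G) (z : Z k) (v : V k), π k g (z • v) = z • π k g v) (C : Submodule ℚ (G → ℚ))
    (hcount : ∑ k, Module.finrank (Z k) (V k) * Module.finrank ℚ (V k) ≤ Module.finrank ℚ C)
    (hfaith : ∀ c ∈ C, (∀ k, ∑ g, c g • π k g = 0) → c = 0)
    (f : ∀ k, V k →ₗ[ℚ] V k) (hf : ∀ k (z : Z k) (v : V k), f k (z • v) = z • f k v) :
    ∃ c ∈ C, ∀ k, ∑ g, c g • π k g = f k := by
  classical
  -- a `Z_k`-basis of each `V_k`
  let b : ∀ k, Module.Basis (Fin (Module.finrank (Z k) (V k))) (Z k) (V k) := fun k => Module.finBasis (Z k) (V k)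
  -- evaluation of `Σ_g c(g) π_k(g)` on the bases
  let Θ : (G → ℚ) →ₗ[ℚ] (∀ k, Fin (Module.finrank (Z k) (V k)) → V k) :=
    { toFun := fun c k i => (∑ g, c g • π k g) (b k i)
      map_add' := fun c c' => by
        funext k i
        simp only [Pi.add_apply, add_smul, Finset.sum_add_distrib, LinearMap.add_apply]
      map_smul' := fun q c => by
        funext k i
        simp only [Pi.smul_apply, smul_eq_mul, RingHom.id_apply, mul_smul, ← Finset.smul_sum,
          LinearMap.smul_apply] }
  let ΘC : C →ₗ[ℚ] (∀ k, Fin (Module.finrank (Z k) (V k)) → V k) := Θ ∘ₗ C.subtype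
  -- injective by FAITHFUL
  have hinj : Function.Injective ΘC := by
    rw [← LinearMap.ker_eq_bot, LinearMap.ker_eq_bot']
    intro c hc
    have hc0 : ∀ k, ∑ g, (c : G → ℚ) g • π k g = 0 := by
      intro k
      refine eq_of_forall_basis (b k) (sum_smul_apply_smul (π k) (hlin k) _) (fun z v => by
        rw [LinearMap.zero_apply, LinearMap.zero_apply, smul_zero]) fun i => ?_
      have := congrFun (congrFun hc k) i
      simpa [ΘC, Θ] using this
    exact Subtype.ext (hfaith c c.2 hc0)
  -- dimension of the target
  have hdim : Module.finrank ℚ (∀ k, Fin (Module.finrank (Z k) (V k)) → V k) =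
      ∑ k, Module.finrank (Z k) (V k) * Module.finrank ℚ (V k) := by
    rw [Module.finrank_pi_fintype ℚ]
    refine Finset.sum_congr rfl fun k _ => ?_
    rw [Module.finrank_pi_fintype ℚ, Finset.sum_const, Finset.card_univ, Fintype.card_fin, smul_eq_mul]
  -- hence bijective
  have hle := LinearMap.finrank_le_finrank_of_injective hinj
  have heq : Module.finrank ℚ C = Module.finrank ℚ (∀ k, Fin (Module.finrank (Z k) (V k)) → V k) :=
    le_antisymm hle (hdim ▸ hcount)
  have hsurj : Function.Surjective ΘC :=
    (LinearMap.injective_iff_surjective_of_finrank_eq_finrank heq).1 hinj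
  obtain ⟨c, hc⟩ := hsurj fun k i => f k (b k i)
  refine ⟨c, c.2, fun k => eq_of_forall_basis (b k) (sum_smul_apply_smul (π k) (hlin k) _) (hf k) fun i => ?_⟩
  have := congrFun (congrFun hc k) i
  simpa [ΘC, Θ] using this

/-- **The units of the certificate**: for every `k` some `e ∈ C` has `Σ_g e(g) π_k(g) = 1` and `Σ_g e(g) π_l(g) = 0` for
`l ≠ k` (the central idempotents of `ℚ[G]`, read through `C`). [cite: Serre1977, §6.5 Prop. 16 and §12.2] -/
theorem exists_mem_sum_smul_eq_single (π : ∀ k, Representation ℚ G (V k))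
    (hlin : ∀ k (g : G) (z : Z k) (v : V k), π k g (z • v) = z • π k g v) (C : Submodule ℚ (G → ℚ))
    (hcount : ∑ k, Module.finrank (Z k) (V k) * Module.finrank ℚ (V k) ≤ Module.finrank ℚ C)
    (hfaith : ∀ c ∈ C, (∀ k, ∑ g, c g • π k g = 0) → c = 0) (k : K) :
    ∃ e ∈ C, ∑ g, e g • π k g = LinearMap.id ∧ ∀ l, l ≠ k → ∑ g, e g • π l g = 0 := by
  classical
  obtain ⟨e, heC, he⟩ := exists_mem_forall_sum_smul_eq π hlin C hcount hfaith
    (Pi.single (M := fun l => V l →ₗ[ℚ] V l) k LinearMap.id) fun l z v => by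
      by_cases hl : l = k
      · subst hl
        rw [Pi.single_eq_same, LinearMap.id_apply, LinearMap.id_apply]
      · rw [Pi.single_eq_of_ne hl, LinearMap.zero_apply, LinearMap.zero_apply, smul_zero]
  refine ⟨e, heC, ?_, fun l hl => ?_⟩
  · rw [he k, Pi.single_eq_same]
  · rw [he l, Pi.single_eq_of_ne hl]

/-! ### §2 Consequences: disjointness, the commutant, the weight `d_k/δ_k = r_k`, irreducibility -/

/-- **PAIRWISE DISJOINT from the certificate: `Hom_G(V_k, V_l) = 0` for `k ≠ l`.**  (`S = S ∘ (Σ_g e(g)π_k(g)) =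
(Σ_g e(g)π_l(g)) ∘ S = 0 ∘ S` for the `k`-th unit `e`.) [cite: Serre1977, §6.5 Prop. 16 and §12.2] -/
theorem intertwiningMap_eq_zero_of_certificate (π : ∀ k, Representation ℚ G (V k))
    (hlin : ∀ k (g : G) (z : Z k) (v : V k), π k g (z • v) = z • π k g v) (C : Submodule ℚ (G → ℚ))
    (hcount : ∑ k, Module.finrank (Z k) (V k) * Module.finrank ℚ (V k) ≤ Module.finrank ℚ C)
    (hfaith : ∀ c ∈ C, (∀ k, ∑ g, c g • π k g = 0) → c = 0) {k l : K} (hkl : k ≠ l)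
    (S : (π k).IntertwiningMap (π l)) : S = 0 := by
  obtain ⟨e, -, hek, hel⟩ := exists_mem_sum_smul_eq_single π hlin C hcount hfaith k
  apply Representation.IntertwiningMap.ext
  ext v
  have h1 : S v = S ((∑ g, e g • π k g) v) := by rw [hek, LinearMap.id_apply]
  have h2 : S ((∑ g, e g • π k g) v) = (∑ g, e g • π l g) (S v) := by
    rw [LinearMap.sum_apply, LinearMap.sum_apply, map_sum]
    refine Finset.sum_congr rfl fun g _ => ?_
    rw [LinearMap.smul_apply, LinearMap.smul_apply, map_smul, S.isIntertwining]
  rw [Representation.IntertwiningMap.toLinearMap_apply, h1, h2, hel l (Ne.symm hkl), LinearMap.zero_apply]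
  rfl

/-- An intertwiner commutes with every `ℚ`-endomorphism of `V_k` commuting with the `Z_k`-scalars (all of them are of the
form `Σ_g c(g) π_k(g)`, §1). [cite: Serre1977, §6.5 Prop. 16 and §12.2] -/
theorem apply_apply_eq_of_certificate (π : ∀ k, Representation ℚ G (V k))
    (hlin : ∀ k (g : G) (z : Z k) (v : V k), π k g (z • v) = z • π k g v) (C : Submodule ℚ (G → ℚ))
    (hcount : ∑ k, Module.finrank (Z k) (V k) * Module.finrank ℚ (V k) ≤ Module.finrank ℚ C)
    (hfaith : ∀ c ∈ C, (∀ k, ∑ g, c g • π k g = 0) → c = 0) (k : K) (S : (π k).IntertwiningMap (π k))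
    (h : V k →ₗ[ℚ] V k) (hh : ∀ (z : Z k) (v : V k), h (z • v) = z • h v) (v : V k) : S (h v) = h (S v) := by
  classical
  obtain ⟨c, -, hc⟩ := exists_mem_forall_sum_smul_eq π hlin C hcount hfaith
    (Pi.single (M := fun l => V l →ₗ[ℚ] V l) k h) fun l z v => by
      by_cases hl : l = k
      · subst hl
        rw [Pi.single_eq_same, hh]
      · rw [Pi.single_eq_of_ne hl, LinearMap.zero_apply, LinearMap.zero_apply, smul_zero]
  have hk : h = ∑ g, c g • π k g := by rw [hc k, Pi.single_eq_same]
  rw [hk, LinearMap.sum_apply, LinearMap.sum_apply, map_sum]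
  refine Finset.sum_congr rfl fun g _ => ?_
  rw [LinearMap.smul_apply, LinearMap.smul_apply, map_smul, S.isIntertwining]

/-- **THE COMMUTANT from the certificate: every `G`-endomorphism of `V_k` is a `Z_k`-scalar**, `S = (v ↦ t • v)`
(`S` commutes with the matrix units of a `Z_k`-basis, §1; `t` = the diagonal entry).  With `smul_isIntertwining` this is
`End_G(V_k) ≅ Z_k`. [cite: Serre1977, §6.5 Prop. 16 and §12.2] -/
theorem exists_smul_eq_of_certificate (π : ∀ k, Representation ℚ G (V k))
    (hlin : ∀ k (g : G) (z : Z k) (v : V k), π k g (z • v) = z • π k g v) (C : Submodule ℚ (G → ℚ))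
    (hcount : ∑ k, Module.finrank (Z k) (V k) * Module.finrank ℚ (V k) ≤ Module.finrank ℚ C)
    (hfaith : ∀ c ∈ C, (∀ k, ∑ g, c g • π k g = 0) → c = 0) (k : K) (S : (π k).IntertwiningMap (π k)) :
    ∃ t : Z k, ∀ v, S v = t • v := by
  classical
  rcases subsingleton_or_nontrivial (V k) with hV | hV
  · exact ⟨0, fun v => by rw [Subsingleton.elim v 0, smul_zero, map_zero]⟩
  let b : Module.Basis (Fin (Module.finrank (Z k) (V k))) (Z k) (V k) := Module.finBasis (Z k) (V k)
  obtain ⟨a₀⟩ := b.index_nonempty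
  have hcomm := apply_apply_eq_of_certificate π hlin C hcount hfaith k S
  -- the `Z_k`-linear maps `u ↦ (b.repr u a) • x`, read as `ℚ`-linear maps
  let E : Fin (Module.finrank (Z k) (V k)) → V k → (V k →ₗ[ℚ] V k) := fun a x =>
    (((b.coord a).smulRight x : V k →ₗ[Z k] V k).toAddMonoidHom).toRatLinearMap
  have hE : ∀ a x (u : V k), E a x u = b.repr u a • x := fun a x u => rfl
  have hEz : ∀ a x (z : Z k) (u : V k), E a x (z • u) = z • E a x u := fun a x z u => by
    rw [hE, hE, b.repr.map_smul, Finsupp.smul_apply, smul_eq_mul, mul_smul]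
  let t : Z k := b.repr (S (b a₀)) a₀
  -- `S (z • b c) = (t z) • b c`
  have hbc : ∀ (z : Z k) (c : Fin (Module.finrank (Z k) (V k))), S (z • b c) = t • z • b c := by
    intro z c
    have h1 : E a₀ (z • b c) (b a₀) = z • b c := by rw [hE, b.repr_self, Finsupp.single_eq_same, one_smul]
    have h2 := hcomm (E a₀ (z • b c)) (hEz a₀ _) (b a₀)
    rw [h1, hE] at h2
    rw [h2]
  refine ⟨t, fun v => ?_⟩
  conv_lhs => rw [← b.sum_repr v]
  conv_rhs => rw [← b.sum_repr v]
  rw [map_sum, Finset.smul_sum]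
  refine Finset.sum_congr rfl fun c _ => ?_
  rw [hbc]

omit [Fintype G] [Fintype K] [∀ k, FiniteDimensional ℚ (V k)] [∀ k, Module.Finite (Z k) (V k)] in
/-- Conversely every `Z_k`-scalar `v ↦ t • v` is a `G`-endomorphism of the `Z_k`-linear representation `π_k`. [folklore] -/
theorem smul_isIntertwining (π : ∀ k, Representation ℚ G (V k))
    (hlin : ∀ k (g : G) (z : Z k) (v : V k), π k g (z • v) = z • π k g v) (k : K) (t : Z k) :
    ∃ S : (π k).IntertwiningMap (π k), ∀ v, S v = t • v :=
  ⟨LinearMap.intertwiningMap_of_isIntertwiningMap (π k) (π k)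
      (DistribSMul.toAddMonoidHom (V k) t).toRatLinearMap fun g v => (hlin k g t v).symm,
    fun _ => rfl⟩

/-- **THE WEIGHT OF MAI'S FORMULA: `δ_k · r_k = d_k`** (`δ_k = dim_ℚ End_G(V_k) = [Z_k:ℚ]` by the commutant theorem,
`d_k = r_k [Z_k:ℚ]`), in the division-free form `dim_ℚ End_G(V_k) · dim_{Z_k} V_k = dim_ℚ V_k`: the `ℚ`-linear bijection
`End_G(V_k)^{r_k} ≅ V_k`, `(S_i)_i ↦ Σ_i S_i(b_i)` for a `Z_k`-basis `(b_i)`. [cite: Serre1977, §6.5 Prop. 16 and §12.2] -/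
theorem finrank_intertwiningMap_mul_eq_of_certificate (π : ∀ k, Representation ℚ G (V k))
    (hlin : ∀ k (g : G) (z : Z k) (v : V k), π k g (z • v) = z • π k g v) (C : Submodule ℚ (G → ℚ))
    (hcount : ∑ k, Module.finrank (Z k) (V k) * Module.finrank ℚ (V k) ≤ Module.finrank ℚ C)
    (hfaith : ∀ c ∈ C, (∀ k, ∑ g, c g • π k g = 0) → c = 0) (k : K) :
    Module.finrank ℚ ((π k).IntertwiningMap (π k)) * Module.finrank (Z k) (V k) = Module.finrank ℚ (V k) := by
  classical
  let b : Module.Basis (Fin (Module.finrank (Z k) (V k))) (Z k) (V k) := Module.finBasis (Z k) (V k)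
  -- `Λ (S_i)_i = Σ_i S_i (b i)`
  let Λ : (Fin (Module.finrank (Z k) (V k)) → (π k).IntertwiningMap (π k)) →ₗ[ℚ] V k :=
    { toFun := fun S => ∑ i, S i (b i)
      map_add' := fun S S' => by
        rw [← Finset.sum_add_distrib]
        rfl
      map_smul' := fun q S => by
        rw [RingHom.id_apply, Finset.smul_sum]
        rfl }
  have hinj : Function.Injective Λ := by
    rw [← LinearMap.ker_eq_bot, LinearMap.ker_eq_bot']
    intro S hS
    choose t ht using fun i => exists_smul_eq_of_certificate π hlin C hcount hfaith k (S i)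
    have h0 : ∑ i, t i • b i = 0 := by
      have : Λ S = ∑ i, t i • b i := by
        change ∑ i, S i (b i) = _
        exact Finset.sum_congr rfl fun i _ => ht i (b i)
      rw [← this, hS]
    have ht0 : ∀ i, t i = 0 := Fintype.linearIndependent_iff.1 b.linearIndependent t h0
    funext i
    apply Representation.IntertwiningMap.ext
    ext v
    rw [Representation.IntertwiningMap.toLinearMap_apply, ht i, ht0 i, zero_smul]
    rfl
  have hsurj : Function.Surjective Λ := by
    intro v
    choose S hS using fun i => smul_isIntertwining π hlin k (b.repr v i)
    refine ⟨S, ?_⟩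
    change ∑ i, S i (b i) = v
    conv_rhs => rw [← b.sum_repr v]
    exact Finset.sum_congr rfl fun i _ => hS i (b i)
  have h := LinearMap.finrank_range_of_inj hinj
  rw [LinearMap.range_eq_top.2 hsurj, finrank_top, Module.finrank_pi_fintype ℚ, Finset.sum_const, Finset.card_univ,
    Fintype.card_fin, smul_eq_mul, mul_comm] at h
  exact h.symm

/-- **IRREDUCIBLE from the certificate**: a non-zero `Z_k`-linear `V_k` is an irreducible `ℚ`-representation — for
`w ≠ 0` and any `v` some `Z_k`-linear `h` has `h(w) = v`, and `h = Σ_g c(g) π_k(g)` (§1) maps the stable subspace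
containing `w` onto `v`. [cite: Serre1977, §6.5 Prop. 16 and §12.2] -/
theorem isIrreducible_of_certificate (π : ∀ k, Representation ℚ G (V k))
    (hlin : ∀ k (g : G) (z : Z k) (v : V k), π k g (z • v) = z • π k g v) (C : Submodule ℚ (G → ℚ))
    (hcount : ∑ k, Module.finrank (Z k) (V k) * Module.finrank ℚ (V k) ≤ Module.finrank ℚ C)
    (hfaith : ∀ c ∈ C, (∀ k, ∑ g, c g • π k g = 0) → c = 0) (k : K) [Nontrivial (V k)] :
    (π k).IsIrreducible := by
  classical
  let b : Module.Basis (Fin (Module.finrank (Z k) (V k))) (Z k) (V k) := Module.finBasis (Z k) (V k)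
  haveI : Nontrivial (Subrepresentation (π k)) := ⟨⊥, ⊤, fun h => by
    have h' := congrArg Subrepresentation.toSubmodule h
    change (⊥ : Submodule ℚ (V k)) = ⊤ at h'
    exact bot_ne_top h'⟩
  refine ⟨fun W => ?_⟩
  by_cases hW : W.toSubmodule = ⊥
  · left
    exact Subrepresentation.toSubmodule_injective hW
  · right
    apply Subrepresentation.toSubmodule_injective
    change W.toSubmodule = ⊤
    obtain ⟨w, hwW, hw0⟩ := Submodule.exists_mem_ne_zero_of_ne_bot hW
    -- a non-zero coordinate of `w`
    have hrepr : b.repr w ≠ 0 := fun h => hw0 (b.repr.map_eq_zero_iff.1 h)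
    obtain ⟨a, ha⟩ : ∃ a, b.repr w a ≠ 0 := by
      by_contra hall
      push Not at hall
      exact hrepr (Finsupp.ext hall)
    rw [eq_top_iff]
    intro v _
    -- the `Z_k`-linear map `u ↦ (b.repr u a) (b.repr w a)⁻¹ • v`, with `h w = v`
    let h : V k →ₗ[ℚ] V k :=
      (((b.coord a).smulRight ((b.repr w a)⁻¹ • v) : V k →ₗ[Z k] V k).toAddMonoidHom).toRatLinearMap
    have hh : ∀ u, h u = b.repr u a • (b.repr w a)⁻¹ • v := fun u => rfl
    have hhz : ∀ (z : Z k) (u : V k), h (z • u) = z • h u := fun z u => by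
      rw [hh, hh, b.repr.map_smul, Finsupp.smul_apply, smul_eq_mul, mul_smul]
    have hhw : h w = v := by rw [hh, ← mul_smul, mul_inv_cancel₀ ha, one_smul]
    obtain ⟨c, -, hc⟩ := exists_mem_forall_sum_smul_eq π hlin C hcount hfaith
      (Pi.single (M := fun l => V l →ₗ[ℚ] V l) k h) fun l z u => by
        by_cases hl : l = k
        · subst hl
          rw [Pi.single_eq_same, hhz]
        · rw [Pi.single_eq_of_ne hl, LinearMap.zero_apply, LinearMap.zero_apply, smul_zero]
    have hk : ∑ g, c g • π k g = h := by rw [hc k, Pi.single_eq_same]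
    rw [← hhw, ← hk, LinearMap.sum_apply]
    refine Submodule.sum_mem _ fun g _ => ?_
    rw [LinearMap.smul_apply]
    exact Submodule.smul_mem _ _ (W.apply_mem_toSubmodule g hwW)

end Summit.HodgeConjecture.CorCM.IrrOdd

end
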